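import Summits.Parity.GeneralizedHardyLittlewood.Theorems.BeyondDiagonalBeatsQuarter.OffDiagPrincipalBlock
import Summits.Parity.GeneralizedHardyLittlewood.Theorems.BeyondDiagonalBeatsQuarter.OffDiagPoissonApplied
import HarnessLib

/-!
# Route `PrimeLevelFamEdge`, crux K_B (stmt-Parity-20343), line `diagonal_kernel_split` rev 4, plan Ω,
# KEYS-NEXT S4 (OMEGA-BLUEPRINT L6 entry, a8P) — **the principal block term at SHORT dual moduli is a FINITE
# lattice-sample sum: for `0 < |h₁| <` box height,
# `Σ_{q∈G} Σ_{s∈ℤ} Φ̂_q(ξ_q, s/h₁ + A/(h₁C_q)) = |h₁|·Σ_{q∈G} Σ_{1 ≤ k ≤ K} e(−sgn(h₁)·A·k/C_q)·𝓕₁Φ_q(ξ_q; |h₁|k)`,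
# with every `s`-series summable (no hypothesis left in `OffDiagPrincipalBlock`)**

Setting (GATE G2 §(a) a8P after the block switch `OffDiagBlockSwitch`/`OffDiagBlockStrata` and the class split
`OffDiagLevelAP`): a finite set `G` of levels `q`, box weights `Φ_q` (smooth, compact support, living on heights
`B₀ < t₂ < B` — for the dyadic box `i`, `(2^{i₂}/2, 2^{i₂+1})`, `boxWeight_ne_zero_mem_box`), first frequencies `ξ_q`,
and the shift `τ_q = A/(h₁·C_q)` of the switched second frequency (`A = ab = (l/d₁)(m/d₂)`, `C_q = q(r+1)`).
`OffDiagPrincipalBlock.principalBlock_eq_latticeSamples` (p641120) rewrote the complete `s`-sums as `|h₁|·Σ_{k∈ℤ}`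
lattice samples `e(−τ_q|h₁|k)·𝓕(t₁ ↦ Φ_q(t₁,|h₁|k))(ξ_q)`. This file makes that object FINITE and explicit — the shape
the a8P-short bound (`OffDiagPrincipalShortBound`: C1-with-phase `MellinBumpPhase` for few turns, the `k`-family large
sieve beyond) consumes:

* §1 `summable_fourier2_intShift` — `s ↦ Φ̂(ξ₁, s/h₁ + τ)` is summable for `uncurry Φ` smooth of compact support and
  `h₁ ≠ 0` (decay `O(|ξ|⁻²)` of the partial transform + modulation + `summable_fourier_div_of_decay`): discharges the
  hypothesis `hsum` of `OffDiagPrincipalBlock.tsum_levelPrincipal_eq_zero_of_height_le` and every later exchange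
  `Σ_q Σ'_s = Σ'_s Σ_q`;
* §2 `fourier_slice_eq_zero_of_not_mem`, **`tsum_latticeSamples_eq_sum_Icc`** — if `Φ(t₁,t₂) ≠ 0 ⇒ B₀ < t₂ < B` then the
  sample `𝓕(t₁ ↦ Φ(t₁, hk))` vanishes unless `B₀ < hk < B`; so for `h ≥ 1` and `B ≤ h(N+1)` the `k`-series is the finite
  sum over `k ∈ [1, N]` (at most `≈ (B − B₀)/h + 1` non-zero samples);
* §3 **`principalBlock_eq_sum_Icc`**, `phase_shift_eq`, **`principalBlock_eq_sum_Icc_phase`** — the headline identity,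
  first with symbolic shifts `τ_q`, then with `τ_q = A/(h₁C_q)`: the phase is `e(−sgn(h₁)·A·k/C_q)`, INDEPENDENT of
  `|h₁|` (the «bilinear Möbius sum with rational phase `e(−lm·k/(d₁d₂q(r+1)))`» of BLUEPRINT §3b once `A = lm/(d₁d₂)`);
* §4 `tsum_levelPrincipal_eq_sum_Icc` — the same after the density factor: `Σ'_s levelPrincipal Q x_s n =
  φ(n)⁻¹·|h₁|·Σ_{q∈Q, q unit mod n} Σ_{k≤N} e(…)·𝓕₁Φ_q(ξ_q; |h₁|k)` (for the a8P bookkeeping `n = |h₁|`);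
* §5 `boxWeight_ne_zero_mem_box`, `boxWeight_height` — the dyadic box weights of Ω-d5 satisfy the support hypotheses
  with `B₀ = 2^{i₂}/2`, `B = 2^{i₂+1}`.

Identities only (no estimate: whether the short-modulus samples total `o(ms)` against the mollifier is L6 proper);
theorems only; standard axioms. Helper toward `stub_offDiagBelowSlack_io`; closes nothing.
«The programme SEARCHES and TYPES; no claim about Landau–Siegel zeros, Theorems 1–2 of arXiv:2211.02515 or
a repaired Margin232 until a kernel theorem says so.»
-/

noncomputable section

open Real MeasureTheory Filter Complex Finset
open scoped FourierTransform Topology ContDiff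

namespace Summit.Parity.GeneralizedHardyLittlewood.Theorems.BeyondDiagonalBeatsQuarter.OffDiag

open Literature.NumberTheory.Sieve.FriedlanderIwaniecPrimes
open Literature.Analysis.Calculus.WhitneyConvex (dyadicBump)
open OffDiagPoissonTwisted (poissonHypotheses_of_contDiff)

/-! ### §1. The shifted-lattice `s`-series of a box transform is summable -/

section Summable

variable {Φ : ℝ → ℝ → ℂ}

/-- **Summability along a shifted lattice, one variable**: for `F` with `𝓕F = O(|ξ|⁻²)`, `h ≠ 0` an integer and
`τ ∈ ℝ`, `s ↦ 𝓕F(s/h + τ)` is summable over `ℤ` (modulation `𝓕(e(−τ·)F)(ξ) = 𝓕F(ξ+τ)` keeps the decay;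
`summable_fourier_div_of_decay`; for `h < 0` re-index `s ↦ −s`). [folklore] -/
theorem summable_fourier_intShift_of_decay {F : ℝ → ℂ}
    (hdec : 𝓕 F =O[cocompact ℝ] fun ξ : ℝ ↦ |ξ| ^ (-2 : ℝ)) {h : ℤ} (hh : h ≠ 0) (τ : ℝ) :
    Summable fun s : ℤ ↦ 𝓕 F ((s : ℝ) / h + τ) := by
  -- the modulated function has the same decay and `𝓕 G (ξ) = 𝓕 F (ξ + τ)`
  have hG := fourier_modulate_isBigO hdec τ
  have hpos : (0 : ℝ) < (h.natAbs : ℝ) := by exact_mod_cast Int.natAbs_pos.mpr hh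
  have hsum : Summable fun s : ℤ ↦ 𝓕 F ((s : ℝ) / (h.natAbs : ℝ) + τ) := by
    have h1 := summable_fourier_div_of_decay hG hpos
    refine h1.congr fun s ↦ ?_
    exact fourier_modulate F τ _
  rcases lt_or_gt_of_ne hh with hneg | hposZ
  · -- `h < 0`: `s/h = (−s)/|h|`
    have habs : ((h.natAbs : ℕ) : ℝ) = -(h : ℝ) := by
      rw [Nat.cast_natAbs, abs_of_neg (by exact_mod_cast hneg), Int.cast_neg]
    rw [← (Equiv.neg ℤ).summable_iff]
    refine hsum.congr fun s ↦ ?_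
    simp only [Function.comp_apply, Equiv.neg_apply, Int.cast_neg, habs]
    rw [div_neg, neg_div]
  · have habs : ((h.natAbs : ℕ) : ℝ) = (h : ℝ) := by
      rw [Nat.cast_natAbs, abs_of_pos (by exact_mod_cast hposZ)]
    rw [habs] at hsum
    exact hsum

/-- **The `s`-series `s ↦ Φ̂(ξ₁, s/h₁ + τ)` is summable** for `uncurry Φ` smooth of compact support, `h₁ ≠ 0`,
`τ, ξ₁ ∈ ℝ` — the hypothesis `hsum` of `OffDiagPrincipalBlock.tsum_levelPrincipal_eq_zero_of_height_le`, discharged.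
[folklore] -/
theorem summable_fourier2_intShift (hΦ : ContDiff ℝ ∞ (Function.uncurry Φ))
    (hΦc : HasCompactSupport (Function.uncurry Φ)) {h₁ : ℤ} (hh : h₁ ≠ 0) (τ ξ₁ : ℝ) :
    Summable fun s : ℤ ↦ fourier2 Φ ξ₁ ((s : ℝ) / h₁ + τ) := by
  obtain ⟨R, C₁, hR, hbox, hc, hs₁, hs₂, hC⟩ := poissonHypotheses_of_contDiff hΦ hΦc
  obtain ⟨R', C₁', hR', hbox', hc', hs₁', hs₂', hC'⟩ :=
    poissonHypotheses_of_contDiff (contDiff_uncurry_swap hΦ) (hasCompactSupport_uncurry_swap hΦc)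
  simp_rw [fourier2_eq_fourier_sliceFourier_swap hbox hc]
  exact summable_fourier_intShift_of_decay (fourier_sliceFourier_isBigO hbox' hc' hR' hs₁' hC' ξ₁) hh τ

/-- **The principal part of one dual modulus vanishes beyond the box height — hypothesis-free form** of
`OffDiagPrincipalBlock.tsum_levelPrincipal_eq_zero_of_height_le` (the `s`-summability is §1). [folklore] -/
theorem tsum_levelPrincipal_eq_zero_of_height_le' (G : Finset ℕ) (Φ : ℕ → ℝ → ℝ → ℂ)
    (hΦ : ∀ q ∈ G, ContDiff ℝ ∞ (Function.uncurry (Φ q)))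
    (hΦc : ∀ q ∈ G, HasCompactSupport (Function.uncurry (Φ q))) {B : ℝ}
    (hsupp : ∀ q ∈ G, ∀ t₁ t₂, Φ q t₁ t₂ ≠ 0 → 0 < t₂ ∧ t₂ < B)
    {h₁ : ℤ} (hh : h₁ ≠ 0) (hB : B ≤ (h₁.natAbs : ℝ)) (ξ₁ τ : ℕ → ℝ) (n : ℕ) :
    ∑' s : ℤ, levelPrincipal G (fun q ↦ fourier2 (Φ q) (ξ₁ q) ((s : ℝ) / h₁ + τ q)) n = 0 :=
  tsum_levelPrincipal_eq_zero_of_height_le G Φ hΦ hΦc hsupp hh hB ξ₁ τ n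
    fun q hq ↦ summable_fourier2_intShift (hΦ q hq) (hΦc q hq) hh (τ q) (ξ₁ q)

end Summable

/-! ### §2. The lattice samples form a finite sum -/

section Finite

variable {Φ : ℝ → ℝ → ℂ}

/-- **A sample outside the height window vanishes.** If `Φ(t₁,t₂) ≠ 0 ⇒ B₀ < t₂ < B` and the height `y` is NOT in
`(B₀, B)`, then `𝓕(t₁ ↦ Φ(t₁, y))(ξ) = 0`. [folklore] -/
theorem fourier_slice_eq_zero_of_not_mem {B₀ B : ℝ} (hsupp : ∀ t₁ t₂, Φ t₁ t₂ ≠ 0 → B₀ < t₂ ∧ t₂ < B)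
    {y : ℝ} (hy : ¬ (B₀ < y ∧ y < B)) (ξ : ℝ) : 𝓕 (fun t₁ : ℝ ↦ Φ t₁ y) ξ = 0 := by
  have hzero : (fun t₁ : ℝ ↦ Φ t₁ y) = fun _ ↦ 0 := by
    funext t₁
    by_contra hne
    exact hy (hsupp t₁ y hne)
  rw [hzero, fourier_eq_integral_ker]
  simp

/-- **The lattice samples form a finite sum.** If `Φ(t₁,t₂) ≠ 0 ⇒ B₀ < t₂ < B` with `0 ≤ B₀`, `h ≥ 1` and
`B ≤ h·(N+1)`, then for any coefficients `e k`:
`Σ'_{k∈ℤ} e k·𝓕(t₁ ↦ Φ(t₁, hk))(ξ) = Σ_{k ∈ [1, N]} e k·𝓕(t₁ ↦ Φ(t₁, hk))(ξ)` (samples with `k ≤ 0` lie at heights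
`≤ 0 ≤ B₀`, samples with `k ≥ N+1` at heights `≥ B`). [folklore] -/
theorem tsum_latticeSamples_eq_sum_Icc {B₀ B : ℝ} (hB₀ : 0 ≤ B₀)
    (hsupp : ∀ t₁ t₂, Φ t₁ t₂ ≠ 0 → B₀ < t₂ ∧ t₂ < B) {h : ℕ} (hh : 0 < h) {N : ℕ}
    (hN : B ≤ (h : ℝ) * (N + 1)) (e : ℤ → ℂ) (ξ : ℝ) :
    ∑' k : ℤ, e k * 𝓕 (fun t₁ : ℝ ↦ Φ t₁ (h * k)) ξ =
      ∑ k ∈ Finset.Icc (1 : ℤ) N, e k * 𝓕 (fun t₁ : ℝ ↦ Φ t₁ (h * k)) ξ := by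
  refine tsum_eq_sum fun k hk ↦ ?_
  rw [Finset.mem_Icc, not_and_or, not_le, not_le] at hk
  have hhr : (0 : ℝ) < h := by exact_mod_cast hh
  have hout : ¬ (B₀ < (h : ℝ) * k ∧ (h : ℝ) * k < B) := by
    rintro ⟨h1, h2⟩
    rcases hk with hk | hk
    · -- `k ≤ 0`: height `hk ≤ 0 ≤ B₀`
      have hk0 : (k : ℝ) ≤ 0 := by exact_mod_cast (show k ≤ 0 by omega)
      have : (h : ℝ) * k ≤ 0 := mul_nonpos_of_nonneg_of_nonpos hhr.le hk0
      linarith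
    · -- `k ≥ N+1`: height `hk ≥ h(N+1) ≥ B`
      have hk1 : ((N : ℝ) + 1) ≤ k := by exact_mod_cast (show (N : ℤ) + 1 ≤ k by omega)
      have : (h : ℝ) * (N + 1) ≤ (h : ℝ) * k := mul_le_mul_of_nonneg_left hk1 hhr.le
      linarith
  rw [fourier_slice_eq_zero_of_not_mem hsupp hout ξ, mul_zero]

/-- The number of heights actually sampled: `𝓕(t₁ ↦ Φ(t₁, hk))(ξ) ≠ 0` forces `B₀/h < k < B/h`. [folklore] -/
theorem lt_and_lt_of_fourier_slice_ne_zero {B₀ B : ℝ} (hsupp : ∀ t₁ t₂, Φ t₁ t₂ ≠ 0 → B₀ < t₂ ∧ t₂ < B)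
    {h : ℕ} (hh : 0 < h) {k : ℤ} {ξ : ℝ} (hne : 𝓕 (fun t₁ : ℝ ↦ Φ t₁ (h * k)) ξ ≠ 0) :
    B₀ / h < (k : ℝ) ∧ (k : ℝ) < B / h := by
  have hhr : (0 : ℝ) < h := by exact_mod_cast hh
  by_contra hnot
  refine hne (fourier_slice_eq_zero_of_not_mem hsupp ?_ ξ)
  rintro ⟨h1, h2⟩
  refine hnot ⟨?_, ?_⟩
  · rw [div_lt_iff₀ hhr]; linarith
  · rw [lt_div_iff₀ hhr]; linarith

end Finite

/-! ### §3. The principal block term at short moduli: the headline identity -/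

/-- **Principal block term = finite lattice-sample sum (symbolic shifts).** For a finite set of levels `G`, box
weights `Φ_q` (smooth, compact support) all living on heights `B₀ < t₂ < B` (`0 ≤ B₀`), `h₁ ≠ 0`, `N` with
`B ≤ |h₁|(N+1)`, frequencies `ξ₁ q` and shifts `τ q`:
`Σ_{q∈G} Σ'_{s∈ℤ} Φ̂_q(ξ₁ q, s/h₁ + τ q) = |h₁|·Σ_{q∈G} Σ_{k∈[1,N]} e(−τ_q|h₁|k)·𝓕(t₁ ↦ Φ_q(t₁,|h₁|k))(ξ₁ q)`.
[folklore] -/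
theorem principalBlock_eq_sum_Icc (G : Finset ℕ) (Φ : ℕ → ℝ → ℝ → ℂ)
    (hΦ : ∀ q ∈ G, ContDiff ℝ ∞ (Function.uncurry (Φ q)))
    (hΦc : ∀ q ∈ G, HasCompactSupport (Function.uncurry (Φ q))) {B₀ B : ℝ} (hB₀ : 0 ≤ B₀)
    (hsupp : ∀ q ∈ G, ∀ t₁ t₂, Φ q t₁ t₂ ≠ 0 → B₀ < t₂ ∧ t₂ < B)
    {h₁ : ℤ} (hh : h₁ ≠ 0) {N : ℕ} (hN : B ≤ (h₁.natAbs : ℝ) * (N + 1)) (ξ₁ τ : ℕ → ℝ) :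
    ∑ q ∈ G, ∑' s : ℤ, fourier2 (Φ q) (ξ₁ q) ((s : ℝ) / h₁ + τ q) =
      (h₁.natAbs : ℂ) * ∑ q ∈ G, ∑ k ∈ Finset.Icc (1 : ℤ) N, (𝐞 (-(τ q * (h₁.natAbs * k))) : ℂ) *
        𝓕 (fun t₁ : ℝ ↦ Φ q t₁ (h₁.natAbs * k)) (ξ₁ q) := by
  rw [principalBlock_eq_latticeSamples G Φ hΦ hΦc hh ξ₁ τ]
  congr 1
  refine Finset.sum_congr rfl fun q hq ↦ ?_
  exact tsum_latticeSamples_eq_sum_Icc hB₀ (hsupp q hq) (Int.natAbs_pos.mpr hh) hN _ _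

/-- **The phase of the lattice samples.** With the switched shift `τ = A/(h₁·C)` (`C ≠ 0`):
`τ·(|h₁|·k) = sgn(h₁)·A·k/C` — the modulus `|h₁|` drops out of the phase. [folklore] -/
theorem phase_shift_eq {h₁ : ℤ} (hh : h₁ ≠ 0) {C : ℝ} (hC : C ≠ 0) (A : ℝ) (k : ℤ) :
    A / ((h₁ : ℝ) * C) * ((h₁.natAbs : ℝ) * k) = (h₁.sign : ℝ) * A * k / C := by
  have hh0 : (h₁ : ℝ) ≠ 0 := by exact_mod_cast hh
  rcases lt_or_gt_of_ne hh with hneg | hpos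
  · have habs : ((h₁.natAbs : ℕ) : ℝ) = -(h₁ : ℝ) := by
      rw [Nat.cast_natAbs, abs_of_neg (by exact_mod_cast hneg), Int.cast_neg]
    rw [habs, Int.sign_eq_neg_one_of_neg hneg]
    push_cast
    field_simp
  · have habs : ((h₁.natAbs : ℕ) : ℝ) = (h₁ : ℝ) := by
      rw [Nat.cast_natAbs, abs_of_pos (by exact_mod_cast hpos)]
    rw [habs, Int.sign_eq_one_of_pos hpos]
    push_cast
    field_simp

/-- **Principal block term at short moduli, switched shifts.** As `principalBlock_eq_sum_Icc`, with the shifts of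
the divisor switch `τ_q = A/(h₁·C_q)` (`A = ab`, `C_q = q·c ≠ 0`): the phase is `e(−sgn(h₁)·A·k/C_q)`:
`Σ_{q∈G} Σ'_{s} Φ̂_q(ξ₁ q, s/h₁ + A/(h₁C_q)) = |h₁|·Σ_{q∈G} Σ_{k∈[1,N]} e(−sgn(h₁)Ak/C_q)·𝓕(t₁ ↦ Φ_q(t₁,|h₁|k))(ξ₁ q)`
— for `A = lm/(d₁d₂)`, `C_q = q(r+1)` this is the bilinear `(l,m)`-phase `e(∓lm·k/(d₁d₂q(r+1)))` of BLUEPRINT §3b.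
[cite: KowalskiMichelVanderKam2000, Lemma 3.3 p. 9 — derivation] -/
theorem principalBlock_eq_sum_Icc_phase (G : Finset ℕ) (Φ : ℕ → ℝ → ℝ → ℂ)
    (hΦ : ∀ q ∈ G, ContDiff ℝ ∞ (Function.uncurry (Φ q)))
    (hΦc : ∀ q ∈ G, HasCompactSupport (Function.uncurry (Φ q))) {B₀ B : ℝ} (hB₀ : 0 ≤ B₀)
    (hsupp : ∀ q ∈ G, ∀ t₁ t₂, Φ q t₁ t₂ ≠ 0 → B₀ < t₂ ∧ t₂ < B)
    {h₁ : ℤ} (hh : h₁ ≠ 0) {N : ℕ} (hN : B ≤ (h₁.natAbs : ℝ) * (N + 1)) (ξ₁ : ℕ → ℝ)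
    (A : ℝ) (Cq : ℕ → ℝ) (hCq : ∀ q ∈ G, Cq q ≠ 0) :
    ∑ q ∈ G, ∑' s : ℤ, fourier2 (Φ q) (ξ₁ q) ((s : ℝ) / h₁ + A / ((h₁ : ℝ) * Cq q)) =
      (h₁.natAbs : ℂ) * ∑ q ∈ G, ∑ k ∈ Finset.Icc (1 : ℤ) N,
        (𝐞 (-((h₁.sign : ℝ) * A * k / Cq q)) : ℂ) * 𝓕 (fun t₁ : ℝ ↦ Φ q t₁ (h₁.natAbs * k)) (ξ₁ q) := by
  rw [principalBlock_eq_sum_Icc G Φ hΦ hΦc hB₀ hsupp hh hN ξ₁ (fun q ↦ A / ((h₁ : ℝ) * Cq q))]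
  congr 1
  refine Finset.sum_congr rfl fun q hq ↦ Finset.sum_congr rfl fun k _ ↦ ?_
  rw [phase_shift_eq hh (hCq q hq) A k]

/-! ### §4. After the density factor: the `s`-sum of `levelPrincipal` -/

open Classical in
/-- **The `s`-sum of the principal parts** (`OffDiagLevelAP.levelPrincipal`, density `φ(n)⁻¹`, any bookkeeping
modulus `n`; for a8P `n = |h₁|`): with `x_s q = Φ̂_q(ξ₁ q, s/h₁ + τ q)`,
`Σ'_{s} levelPrincipal G x_s n = φ(n)⁻¹·|h₁|·Σ_{q∈G, q unit mod n} Σ_{k∈[1,N]} e(−τ_q|h₁|k)·𝓕(t₁ ↦ Φ_q(t₁,|h₁|k))(ξ₁ q)`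
(exchange by §1, lattice samples by §3). [folklore] -/
theorem tsum_levelPrincipal_eq_sum_Icc (G : Finset ℕ) (Φ : ℕ → ℝ → ℝ → ℂ)
    (hΦ : ∀ q ∈ G, ContDiff ℝ ∞ (Function.uncurry (Φ q)))
    (hΦc : ∀ q ∈ G, HasCompactSupport (Function.uncurry (Φ q))) {B₀ B : ℝ} (hB₀ : 0 ≤ B₀)
    (hsupp : ∀ q ∈ G, ∀ t₁ t₂, Φ q t₁ t₂ ≠ 0 → B₀ < t₂ ∧ t₂ < B)
    {h₁ : ℤ} (hh : h₁ ≠ 0) {N : ℕ} (hN : B ≤ (h₁.natAbs : ℝ) * (N + 1)) (ξ₁ τ : ℕ → ℝ) (n : ℕ) :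
    ∑' s : ℤ, levelPrincipal G (fun q ↦ fourier2 (Φ q) (ξ₁ q) ((s : ℝ) / h₁ + τ q)) n =
      (Nat.totient n : ℂ)⁻¹ * ((h₁.natAbs : ℂ) *
        ∑ q ∈ G.filter (fun q : ℕ ↦ IsUnit ((q : ℕ) : ZMod n)), ∑ k ∈ Finset.Icc (1 : ℤ) N,
          (𝐞 (-(τ q * (h₁.natAbs * k))) : ℂ) * 𝓕 (fun t₁ : ℝ ↦ Φ q t₁ (h₁.natAbs * k)) (ξ₁ q)) := by
  classical
  simp only [levelPrincipal, levelCoprimeSum]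
  rw [tsum_mul_left]
  have hG' : ∀ q ∈ G.filter (fun q : ℕ ↦ IsUnit ((q : ℕ) : ZMod n)), q ∈ G := fun q hq ↦ (Finset.mem_filter.mp hq).1
  rw [Summable.tsum_finsetSum (fun q hq ↦ summable_fourier2_intShift (hΦ q (hG' q hq)) (hΦc q (hG' q hq)) hh _ _)]
  rw [principalBlock_eq_sum_Icc (G.filter (fun q : ℕ ↦ IsUnit ((q : ℕ) : ZMod n))) Φ
    (fun q hq ↦ hΦ q (hG' q hq)) (fun q hq ↦ hΦc q (hG' q hq)) hB₀ (fun q hq ↦ hsupp q (hG' q hq)) hh hN ξ₁ τ]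

/-! ### §5. The dyadic box weights satisfy the support hypotheses -/

section Box

variable {q d₁ d₂ α β r : ℕ}

/-- **Support of the box weight `Φ_i` of Ω-d5**: `Φ_i(t₁,t₂) ≠ 0 ⇒ 2^{i₁}/2 < t₁ < 2^{i₁+1} ∧ 2^{i₂}/2 < t₂ < 2^{i₂+1}`.
[folklore] -/
theorem boxWeight_ne_zero_mem_box (i : ℕ × ℕ) {t₁ t₂ : ℝ} (h : boxWeight q d₁ d₂ α β r i t₁ t₂ ≠ 0) :
    ((2 : ℝ) ^ i.1 / 2 < t₁ ∧ t₁ < 2 ^ (i.1 + 1)) ∧ ((2 : ℝ) ^ i.2 / 2 < t₂ ∧ t₂ < 2 ^ (i.2 + 1)) := by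
  have hθ : dyadicBump (t₁ / 2 ^ i.1) * dyadicBump (t₂ / 2 ^ i.2) ≠ 0 := by
    intro h0
    apply h
    rw [boxWeight, h0, Complex.ofReal_zero, zero_mul]
  have hm := mem_box_of_dyadicBump₂_ne_zero (K₁ := (2 : ℝ) ^ i.1) (K₂ := (2 : ℝ) ^ i.2) (y := (t₁, t₂))
    (by positivity) (by positivity) hθ
  simp only at hm
  obtain ⟨⟨a1, a2⟩, ⟨b1, b2⟩⟩ := hm
  refine ⟨⟨a1, by rw [pow_succ]; linarith⟩, ⟨b1, by rw [pow_succ]; linarith⟩⟩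

/-- **Height support of the box weight** in the form §2–§4 consume: `Φ_i(t₁,t₂) ≠ 0 ⇒ 2^{i₂}/2 < t₂ < 2^{i₂+1}`
(so `B₀ = 2^{i₂}/2 ≥ 0`, `B = 2^{i₂+1}`, and `N+1 ≥ 2^{i₂+1}/|h₁|` samples suffice). [folklore] -/
theorem boxWeight_height (i : ℕ × ℕ) :
    ∀ t₁ t₂ : ℝ, boxWeight q d₁ d₂ α β r i t₁ t₂ ≠ 0 → (2 : ℝ) ^ i.2 / 2 < t₂ ∧ t₂ < 2 ^ (i.2 + 1) :=
  fun _ _ h ↦ (boxWeight_ne_zero_mem_box i h).2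

/-- The weaker `(0, 2^{i₂+1})` window used by `OffDiagPrincipalBlock.principalBlock_eq_zero_of_height_le`:
for `|h₁| ≥ 2^{i₂+1}` the principal block term of box `i` vanishes. [folklore] -/
theorem boxWeight_height_pos (i : ℕ × ℕ) :
    ∀ t₁ t₂ : ℝ, boxWeight q d₁ d₂ α β r i t₁ t₂ ≠ 0 → 0 < t₂ ∧ t₂ < 2 ^ (i.2 + 1) :=
  fun _ _ h ↦ ⟨lt_trans (by positivity) (boxWeight_ne_zero_mem_box i h).2.1, (boxWeight_ne_zero_mem_box i h).2.2⟩

end Box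

end Summit.Parity.GeneralizedHardyLittlewood.Theorems.BeyondDiagonalBeatsQuarter.OffDiag
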